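import Summits.ResolutionOfSingularities.ResolutionOfSingularities.Theorems.WeightedInvariantLocalWeightedDropNCToricRungGlue
import Summits.ResolutionOfSingularities.ResolutionOfSingularities.Theorems.WeightedInvariantLocalWeightedDropNCGameToricStep

/-!
# TOT rung R6 (toric / Newton non-degenerate) of `NCTransport.HTOT m` — CLOSED

Crux item stmt-ResolutionOfSingularities-8899 `WeightedInvariant.LocalWeightedDrop` (route `ResolutionOfSingularities/WeightedInvariant`), line
`nc-game-transport`.  [OURS · L1 W4.3 · seat res-D-pv-006; def-free; NOT a statement of any manuscript.]

`NCTransport.TOTRungNonDegenerate m` (typed by strategist res-L1-w43-strat-1, tree file `…NCToricRung`): every non-zero germ in `m + 1` variables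
over an algebraically closed field of characteristic `p` that is NEWTON NON-DEGENERATE on compact faces (log-Jacobian sense) is won by the mover of
the count game within finitely many rounds — every `m`, every `p`.  Assembly: the strategist's `totRungNonDegenerate_of_toric` (cloud game with a
UNIFORM round bound, `…NCToricRung`) + (b) `toricStep` (res-D-pv-006, `…NCGameToricStep`) + (c) `toricEnd` (res-type-088, `…NCGameToricEnd`),
glued by res-type-088's `totRungNonDegenerate_of_toricStep` (`…NCToricRungGlue`).  Corollaries: the coordinate-free form and, through
`NCTransport.won_of_winsIn`, the WEIGHTED game: every such germ and every divisor of its powers is `CobordantGame.Won k (m + 1)`.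
A BC5-type witness family for the line in every dimension; no leverage on the residual `HTOT m`, `m ≥ 3`, is claimed (STRATEGY-CENSUS v1.3).
-/

set_option linter.dupNamespace false -- mandated namespace of this single-conjunct summit

namespace Summit.ResolutionOfSingularities.ResolutionOfSingularities.Theorems

namespace NCTransport

open MvPowerSeries Literature.AlgebraicGeometry.Resolution TameFourTupleDrop

/-- **TOT RUNG R6 (NEWTON NON-DEGENERATE GERMS), PROVED**: every non-zero germ in `m + 1` variables over an algebraically closed field of
characteristic `p` that is Newton non-degenerate on compact faces (log-Jacobian sense) is won by the mover of the count game in finitely many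
rounds — every `m`, every `p`.  (`totRungNonDegenerate_of_toricStep` = res-type-088's (c) `toricEnd` + the strategist's assembly; (b) `toricStep` of `…NCGameToricStep`.) -/
theorem totRungNonDegenerate (m : ℕ) : TOTRungNonDegenerate m :=
  totRungNonDegenerate_of_toricStep m (toricStep m)

/-- The coordinate-free form: Newton non-degenerate after SOME legal formal coordinate change suffices. -/
theorem totRungNonDegenerateFree (m : ℕ) : TOTRungNonDegenerateFree m :=
  totRungNonDegenerateFree_of_toricStep m (toricStep m)

/-- **R6 IN THE WEIGHTED GAME**: a non-zero Newton non-degenerate germ in `m + 1` variables over an algebraically closed field of characteristic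
`p` is `CobordantGame.Won k (m + 1)`. -/
theorem won_of_newtonNonDegenerate {m : ℕ} (p : ℕ) (hp : p.Prime) (k : Type) [Field k] [CharP k p] [IsAlgClosed k]
    (b : MvPowerSeries (Fin (m + 1)) k) (hb : b ≠ 0) (hND : NewtonNonDegenerate b) : CobordantGame.Won k (m + 1) b :=
  won_of_totRungNonDegenerate (totRungNonDegenerate m) p hp k b hb hND

/-- … and so is every divisor of each of its powers. -/
theorem won_of_dvd_pow_of_newtonNonDegenerate {m : ℕ} (p : ℕ) (hp : p.Prime) (k : Type) [Field k] [CharP k p] [IsAlgClosed k]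
    (b : MvPowerSeries (Fin (m + 1)) k) (hb : b ≠ 0) (hND : NewtonNonDegenerate b) (N : ℕ) (f : MvPowerSeries (Fin (m + 1)) k)
    (hf : f ∣ b ^ (N + 1)) : CobordantGame.Won k (m + 1) f :=
  won_of_dvd_pow_of_totRungNonDegenerate (totRungNonDegenerate m) p hp k b hb hND N f hf

end NCTransport

end Summit.ResolutionOfSingularities.ResolutionOfSingularities.Theorems
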